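import Summits.Langlands.Langlands.Theses.SkinnerWilesDefectOne
import Literature.NumberTheory.Automorphic.OrdinaryCompletedCohomologyGL

/-!
# `ProModularOrdinaryClassical` (stmt-Langlands-12921) — Negative knowledge VI: the slot-`0`
# diamond weight of an ordinary point is an invariant, and `stub_slotZeroDiamondWeight` (line
# `top-degree-exact-control`, skeleton rev 2) is false as soon as ONE associated point of non-zero
# slot-`0` weight exists

From the standing disprover's `Cruxes/ProModularOrdinaryClassical/Disproof.lean` (cdisprove gen 3,
cycle 3, §9), formalising the convention-free core of the drefute note
`Cruxes/ProModularOrdinaryClassical/NegativeNotes-drefute-slotZeroDiamondWeight.md`.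

For a `ℚ̄_p`-point `x` of Hida's ordinary big Hecke algebra `𝕋^{S,ord}(𝒰)` of `GL₂/F` say that
**slot `0` of `x` has weight `j ∈ ℤ`** (`HasSlotZeroWeight 𝒰 x j`) when, up to `N₀`-th powers, the
product over `v ∣ p` of the diamond eigenvalues `x(⟨diag(û_v, 1)⟩_v)` is `N_{F/ℚ}(u)^j` for every
global `u ∈ 𝓞 F` that is a unit above `p` — the shape of the conclusion of the registered stub
`stub_slotZeroDiamondWeight` (weight `0`) and of the slot-`0` clause of `HasDominantDiamondWeight`.

* `HasDiamondWeight.unique` / `HasSlotZeroWeight.unique` — **algebraic weights are well defined**: a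
  quantity `P(u, û)` (centre product, slot-`0` product, slot-`1` product of the diamond eigenvalues …) has
  at most one weight `j` with `P^{N₀} = (N(u)^j)^{N₀}` for all compatible `(u, û)`. Witness `u = p + 1` (a
  unit at every `v ∣ p` — `exists_units_coe_eq_algebraMap`; conversely `not_mem_asIdeal_of_units`: the
  `û`-binder is inhabited iff `u` is prime to `p` — of norm `(p+1)^{[F:ℚ]} > 1`; a non-zero integral power
  of an integer `> 1` is never `1` in characteristic `0`). No automorphic input: `x` is any function.
* `hasSlotZeroWeight_zero_of_stub` — the registered stub (its signature INLINED byte-for-byte as the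
  hypothesis `hstub`; Cruxes modules are not importable here, and a closed `def … : Prop` restating it
  would be relocated to `Literature/` by the gate) says exactly "every continuous point ord-associated with
  an irreducible Galois-ordinary `ρ` (parallel weight `k ≥ 2`, exponent `m > 0`) at a level maximal above
  `p` has slot-`0` weight `0`".
* `stubSlotZeroDiamondWeight_false_of_hasSlotZeroWeight` — hence ONE such point with slot-`0` weight
  `j ≠ 0` refutes the stub (conclusion: `¬` the registered signature, verbatim). The packaged form
  `NonzeroSlotZeroWeightPoint → ¬ Stub` (H = "such a point exists") is kept in the crux work file
  `Cruxes/ProModularOrdinaryClassical/Disproof.lean` §9b, not here.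

Why the hypothesis H ("an associated point of non-zero slot-`0` weight meeting the stub's hypotheses
exists") is TRUE (paper; not constructible in the tree, which attaches no Galois representation to any
Hecke eigensystem): whenever `ρ|Γ_{F_v}` SPLITS at the places
above `p` — every CM point with `p` split in the CM field, e.g. `F = ℚ(√-11)`, `p = 5`,
`ρ = V₅(y² = x³ - x)|Γ_F` (irreducible on `Γ_F`, ordinary of weight `2`, `m = 1`) — the same spherical
eigensystem is carried by the TWO Borel-ordinary refinements, both continuous points of
`𝕋^{S,ord}(𝒰)` (`IsOrdAssociated` reads only `T_{w,1}, T_{w,2}`, `w ∉ S`), whose slot-`0` weights differ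
by `±(k-1) ≠ 0` (the ratio of the two diamond characters on slot `0` is `(θ₁/θ₂)∘Art_v = Nm^{∓(k-1)}·`finite);
by `HasSlotZeroWeight.unique` at most one of them has weight `0`. The companion point is Hida's /
Breuil–Emerton's (Astérisque 331, Thm 1.1.3 over `ℚ`); over `F` it is the specialisation of the CM
component of the nearly ordinary Hecke algebra (interpolation of classical `Σ`-ordinary CM points).
So the stub, universally quantified over `x`, cannot hold; the line must carry the ordering inside the
existential output of its transfer stub (drefute repair R1). This file changes no verdict on the crux.
[folklore]
-/

set_option linter.dupNamespace false

namespace Summit.Langlands.Langlands.Theorems.ProModularOrdinaryClassical.Negative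

open Literature.NumberTheory.Automorphic Literature.NumberTheory.GaloisRepresentations
open Literature.NumberTheory.Automorphic.BigHeckeGLn
open NumberField IsDedekindDomain Filter

/-! ## Arithmetic helpers (no automorphic content) -/

section Helpers

/-- A non-zero integral power of an integer `c > 1` is never `1` in a field of characteristic `0`.
[folklore] -/
theorem int_cast_zpow_ne_one {K : Type*} [Field K] [CharZero K] {c : ℤ} (hc : 1 < c) {M : ℤ}
    (hM : M ≠ 0) : (c : K) ^ M ≠ 1 := by
  intro h
  have h' : ((c : ℚ) : K) ^ M = ((1 : ℚ) : K) := by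
    rw [Rat.cast_intCast, Rat.cast_one, h]
  rw [← Rat.cast_zpow, Rat.cast_inj] at h'
  have hinj := zpow_right_injective₀ (a := (c : ℚ)) (by exact_mod_cast (zero_lt_one.trans hc))
    (by exact_mod_cast hc.ne')
  exact hM (hinj (by simpa using h'))

variable {F : Type} [Field F] {p : ℕ}

/-- If `p ∈ v` then `p + 1 ∉ v` (else `1 ∈ v`). [folklore] -/
theorem natCast_succ_not_mem_asIdeal {v : HeightOneSpectrum (𝓞 F)} (hv : (p : 𝓞 F) ∈ v.asIdeal) :
    ((p + 1 : ℕ) : 𝓞 F) ∉ v.asIdeal := by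
  intro h
  apply v.isPrime.ne_top
  rw [Ideal.eq_top_iff_one]
  have e : ((p + 1 : ℕ) : 𝓞 F) - (p : 𝓞 F) = 1 := by push_cast; ring
  rw [← e]
  exact v.asIdeal.sub_mem h hv

variable [NumberField F]

/-- **Global elements prime to `p` give compatible local units.** If `u ∈ 𝓞 F` lies in no prime
above `p`, then at every `v ∣ p` the image of `u` in `F_v` is a unit of `𝒪_v`
(`intValuation_eq_one_iff` + `adicCompletionIntegers.isUnit_iff_valued_eq_one`): the family `û` the
diamond-weight statements quantify over EXISTS for such `u`. [folklore] -/
theorem exists_units_coe_eq_algebraMap (u : 𝓞 F)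
    (hu : ∀ v : HeightOneSpectrum (𝓞 F), (p : 𝓞 F) ∈ v.asIdeal → u ∉ v.asIdeal) :
    ∃ û : ∀ v : HeightOneSpectrum (𝓞 F), (p : 𝓞 F) ∈ v.asIdeal → (v.adicCompletionIntegers F)ˣ,
      ∀ (v : HeightOneSpectrum (𝓞 F)) (hv : (p : 𝓞 F) ∈ v.asIdeal),
        ((û v hv : v.adicCompletionIntegers F) : v.adicCompletion F) =
          algebraMap F (v.adicCompletion F) (u : F) := by
  have key : ∀ v : HeightOneSpectrum (𝓞 F), (p : 𝓞 F) ∈ v.asIdeal →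
      ∃ w : (v.adicCompletionIntegers F)ˣ,
        ((w : v.adicCompletionIntegers F) : v.adicCompletion F) =
          algebraMap F (v.adicCompletion F) (u : F) := by
    intro v hv
    have hmem : algebraMap F (v.adicCompletion F) (u : F) ∈ v.adicCompletionIntegers F :=
      HeightOneSpectrum.coe_algebraMap_mem (𝓞 F) F v u
    have hval : Valued.v (algebraMap F (v.adicCompletion F) (u : F)) = 1 := by
      have e := HeightOneSpectrum.valuedAdicCompletion_eq_valuation' (v := v) (u : F)
      rw [show ((u : F) : v.adicCompletion F) = algebraMap F (v.adicCompletion F) (u : F) from rfl] at e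
      rw [e, show (u : F) = algebraMap (𝓞 F) F u from rfl, HeightOneSpectrum.valuation_of_algebraMap,
        HeightOneSpectrum.intValuation_eq_one_iff]
      exact hu v hv
    have hunit : IsUnit (⟨_, hmem⟩ : v.adicCompletionIntegers F) :=
      HeightOneSpectrum.adicCompletionIntegers.isUnit_iff_valued_eq_one.2 hval
    exact ⟨hunit.unit, by rw [IsUnit.unit_spec]⟩
  choose û hû using key
  exact ⟨û, hû⟩

/-- Conversely a compatible local unit at `v ∣ p` forces `u ∉ v`: the `û`-binder of the diamond-weight
statements is EMPTY — the instance vacuous — for `u = 0` and for every `u` lying in some prime above `p`.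
So those statements quantify exactly over the global `u` prime to `p`. [folklore] -/
theorem not_mem_asIdeal_of_units (u : 𝓞 F) (v : HeightOneSpectrum (𝓞 F))
    (w : (v.adicCompletionIntegers F)ˣ)
    (hw : ((w : v.adicCompletionIntegers F) : v.adicCompletion F) =
      algebraMap F (v.adicCompletion F) (u : F)) :
    u ∉ v.asIdeal := by
  have h1 : Valued.v ((w : v.adicCompletionIntegers F) : v.adicCompletion F) = 1 :=
    HeightOneSpectrum.adicCompletionIntegers.isUnit_iff_valued_eq_one.1 (Units.isUnit w)
  rw [hw] at h1
  have e := HeightOneSpectrum.valuedAdicCompletion_eq_valuation' (v := v) (u : F)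
  rw [show ((u : F) : v.adicCompletion F) = algebraMap F (v.adicCompletion F) (u : F) from rfl] at e
  rw [e, show (u : F) = algebraMap (𝓞 F) F u from rfl, HeightOneSpectrum.valuation_of_algebraMap,
    HeightOneSpectrum.intValuation_eq_one_iff] at h1
  exact h1

/-- `N_{F/ℚ}(n) = n^{[F:ℚ]}` for a natural number `n` viewed in `𝓞 F`. [folklore] -/
theorem norm_natCast_ringOfIntegers (n : ℕ) :
    Algebra.norm ℤ ((n : ℕ) : 𝓞 F) = ((n : ℕ) : ℤ) ^ Module.finrank ℚ F := by
  rw [Algebra.norm_natCast, RingOfIntegers.rank]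

/-- `N_{F/ℚ}(p + 1) > 1` (`p ≥ 1`, `[F:ℚ] ≥ 1`). [folklore] -/
theorem one_lt_norm_natCast_succ [Fact p.Prime] :
    1 < Algebra.norm ℤ (((p + 1 : ℕ) : 𝓞 F)) := by
  rw [norm_natCast_ringOfIntegers]
  have hd : Module.finrank ℚ F ≠ 0 := Module.finrank_pos.ne'
  have hp : (1 : ℤ) < ((p + 1 : ℕ) : ℤ) := by
    have := (Fact.out : p.Prime).one_lt
    omega
  exact one_lt_pow₀ hp hd

end Helpers

/-! ## Diamond weights: a quantity on (u, û) has AT MOST ONE algebraic weight -/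

section DiamondWeight

variable {F : Type} [Field F] [NumberField F] {p : ℕ} [Fact p.Prime]

/-- **`P` has algebraic weight `j`** (up to `N₀`-th powers): for an arbitrary `ℚ̄_p`-valued quantity
`P(u, û)` attached to a global `u ∈ 𝓞 F` and a compatible family `û` of local units at the places above
`p` — the centre product `∏_{v∣p} x(⟨diag(û_v,û_v)⟩_v)` of `stub_centralDiamondWeight` (weight `2 - k`), the
slot-`0` product of `stub_slotZeroDiamondWeight` (weight `0`), the slot-`1` product of
`HasDominantDiamondWeight` (weight `2 - k`) — `P(u,û)^{N₀} = (N_{F/ℚ}(u)^j)^{N₀}` for all compatible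
`(u, û)`. [folklore] -/
def HasDiamondWeight
    (P : ∀ (u : NumberField.RingOfIntegers F),
      (∀ v : IsDedekindDomain.HeightOneSpectrum (NumberField.RingOfIntegers F),
        (p : NumberField.RingOfIntegers F) ∈ v.asIdeal → (v.adicCompletionIntegers F)ˣ) → PadicAlgCl p)
    (j : ℤ) : Prop :=
  ∃ N₀ : ℕ, 0 < N₀ ∧ ∀ (u : NumberField.RingOfIntegers F)
    (û : ∀ v : IsDedekindDomain.HeightOneSpectrum (NumberField.RingOfIntegers F),
      (p : NumberField.RingOfIntegers F) ∈ v.asIdeal → (v.adicCompletionIntegers F)ˣ),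
    (∀ (v : IsDedekindDomain.HeightOneSpectrum (NumberField.RingOfIntegers F))
        (hv : (p : NumberField.RingOfIntegers F) ∈ v.asIdeal),
        ((û v hv : v.adicCompletionIntegers F) : v.adicCompletion F) =
          algebraMap F (v.adicCompletion F) (u : F)) →
    P u û ^ N₀ = (((Algebra.norm ℤ u : ℤ) : PadicAlgCl p) ^ j) ^ N₀

/-- **Algebraic weights are unique.** If `P` has weights `j` and `j'` then `j = j'`: evaluate both at
the global unit-above-`p` `u = p + 1` (`exists_units_coe_eq_algebraMap`), whose norm `(p+1)^{[F:ℚ]}`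
exceeds `1`, and compare exponents in characteristic `0` (`int_cast_zpow_ne_one`). Pure arithmetic: `P`
is ANY function — no continuity, no association, no automorphic input. In particular the centre weight of
`stub_centralDiamondWeight` and the slot weights of `HasDominantDiamondWeight` are invariants of the point.
[folklore] -/
theorem HasDiamondWeight.unique
    {P : ∀ (u : NumberField.RingOfIntegers F),
      (∀ v : IsDedekindDomain.HeightOneSpectrum (NumberField.RingOfIntegers F),
        (p : NumberField.RingOfIntegers F) ∈ v.asIdeal → (v.adicCompletionIntegers F)ˣ) → PadicAlgCl p}
    {j j' : ℤ} (h : HasDiamondWeight P j) (h' : HasDiamondWeight P j') : j = j' := by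
  obtain ⟨N, hN, hS⟩ := h
  obtain ⟨N', hN', hS'⟩ := h'
  set u : 𝓞 F := ((p + 1 : ℕ) : 𝓞 F) with hu
  obtain ⟨û, hû⟩ := exists_units_coe_eq_algebraMap (p := p) u
    (fun v hv => natCast_succ_not_mem_asIdeal hv)
  have e1 := hS u û hû
  have e2 := hS' u û hû
  set c : ℤ := Algebra.norm ℤ u with hc
  have hc1 : 1 < c := one_lt_norm_natCast_succ
  -- both sides raised to the common exponent `N * N'`
  have key : ((c : PadicAlgCl p) ^ j) ^ (N * N') = ((c : PadicAlgCl p) ^ j') ^ (N * N') := by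
    rw [pow_mul, ← e1, ← pow_mul, mul_comm N N', pow_mul, e2, ← pow_mul]
  have hc0 : (c : PadicAlgCl p) ≠ 0 := by exact_mod_cast (zero_lt_one.trans hc1).ne'
  have key' : (c : PadicAlgCl p) ^ ((j - j') * ((N * N' : ℕ) : ℤ)) = 1 := by
    rw [sub_mul, zpow_sub₀ hc0, div_eq_one_iff_eq (zpow_ne_zero _ hc0), zpow_mul, zpow_mul,
      zpow_natCast, zpow_natCast, key]
  by_contra hne
  refine int_cast_zpow_ne_one (K := PadicAlgCl p) hc1 ?_ key'
  refine mul_ne_zero (sub_ne_zero.2 hne) ?_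
  exact_mod_cast (Nat.mul_pos hN hN').ne'

end DiamondWeight

/-! ## The slot-`0` weight of a point of `𝕋^{S,ord}(𝒰)` -/

section SlotZero

variable {F : Type} [Field F] [NumberField F] {p : ℕ} [Fact p.Prime]

/-- **Slot `0` of the diamond character of `x` has weight `j`** (up to `N₀`-th powers): for every
global `u ∈ 𝓞 F` that is a unit at every `v ∣ p` and every compatible family of local units `û`,
`(∏_{v ∣ p} x(⟨diag(û_v, 1)⟩_v))^{N₀} = (N_{F/ℚ}(u)^j)^{N₀}`. Weight `0` is the conclusion of
`stub_slotZeroDiamondWeight` and the slot-`0` clause of the line's `HasDominantDiamondWeight`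
(classical parallel-weight-`k` points: type `(0, 2-k)`); the companion refinement of a split-at-`p`
point has slot-`0` weight `±(k-1)`. The binders are those of the registered stub, verbatim.
[folklore] -/
def HasSlotZeroWeight (𝒰 : TameLevel 2 F p) (x : OrdinaryHeckeAlgebraGLn 𝒰 →+* PadicAlgCl p)
    (j : ℤ) : Prop :=
  ∃ N₀ : ℕ, 0 < N₀ ∧ ∀ (u : NumberField.RingOfIntegers F)
    (û : ∀ v : IsDedekindDomain.HeightOneSpectrum (NumberField.RingOfIntegers F),
      (p : NumberField.RingOfIntegers F) ∈ v.asIdeal → (v.adicCompletionIntegers F)ˣ),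
    (∀ (v : IsDedekindDomain.HeightOneSpectrum (NumberField.RingOfIntegers F))
        (hv : (p : NumberField.RingOfIntegers F) ∈ v.asIdeal),
        ((û v hv : v.adicCompletionIntegers F) : v.adicCompletion F) =
          algebraMap F (v.adicCompletion F) (u : F)) →
    (∏ᶠ v : {v : IsDedekindDomain.HeightOneSpectrum (NumberField.RingOfIntegers F) //
        (p : NumberField.RingOfIntegers F) ∈ v.asIdeal},
      x (𝒰.ordDiamond v.2 (Pi.mulSingle (0 : Fin 2) (û v.1 v.2)))) ^ N₀ =
      (((Algebra.norm ℤ u : ℤ) : PadicAlgCl p) ^ j) ^ N₀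

omit [NumberField F] [Fact p.Prime] in
/-- Weight `0` is "slot `0` is torsion" — the literal shape of the stub's conclusion. [folklore] -/
theorem hasSlotZeroWeight_zero_iff [NumberField F] [Fact p.Prime] (𝒰 : TameLevel 2 F p)
    (x : OrdinaryHeckeAlgebraGLn 𝒰 →+* PadicAlgCl p) :
    HasSlotZeroWeight 𝒰 x 0 ↔
      ∃ N : ℕ, 0 < N ∧ ∀ (u : NumberField.RingOfIntegers F)
        (û : ∀ v : IsDedekindDomain.HeightOneSpectrum (NumberField.RingOfIntegers F),
          (p : NumberField.RingOfIntegers F) ∈ v.asIdeal → (v.adicCompletionIntegers F)ˣ),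
        (∀ (v : IsDedekindDomain.HeightOneSpectrum (NumberField.RingOfIntegers F))
            (hv : (p : NumberField.RingOfIntegers F) ∈ v.asIdeal),
            ((û v hv : v.adicCompletionIntegers F) : v.adicCompletion F) =
              algebraMap F (v.adicCompletion F) (u : F)) →
        (∏ᶠ v : {v : IsDedekindDomain.HeightOneSpectrum (NumberField.RingOfIntegers F) //
            (p : NumberField.RingOfIntegers F) ∈ v.asIdeal},
          x (𝒰.ordDiamond v.2 (Pi.mulSingle (0 : Fin 2) (û v.1 v.2)))) ^ N = 1 := by
  simp only [HasSlotZeroWeight, zpow_zero, one_pow]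

/-- **The slot-`0` weight is an invariant of the point** (`HasDiamondWeight.unique` for the slot-`0`
product; `HasSlotZeroWeight 𝒰 x j` is `HasDiamondWeight (slot-0 product of x) j` by `rfl`). `x` is ANY map:
no continuity, no association, no automorphic input. [folklore] -/
theorem HasSlotZeroWeight.unique {𝒰 : TameLevel 2 F p}
    {x : OrdinaryHeckeAlgebraGLn 𝒰 →+* PadicAlgCl p} {j j' : ℤ}
    (h : HasSlotZeroWeight 𝒰 x j) (h' : HasSlotZeroWeight 𝒰 x j') : j = j' :=
  HasDiamondWeight.unique
    (P := fun _ û => ∏ᶠ v : {v : IsDedekindDomain.HeightOneSpectrum (NumberField.RingOfIntegers F) //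
        (p : NumberField.RingOfIntegers F) ∈ v.asIdeal},
      x (𝒰.ordDiamond v.2 (Pi.mulSingle (0 : Fin 2) (û v.1 v.2))))
    h h'

/-- In particular slot `0` cannot be torsion (weight `0`) at a point of non-zero slot-`0` weight.
[folklore] -/
theorem HasSlotZeroWeight.not_weight_zero {𝒰 : TameLevel 2 F p}
    {x : OrdinaryHeckeAlgebraGLn 𝒰 →+* PadicAlgCl p} {j : ℤ} (h : HasSlotZeroWeight 𝒰 x j)
    (hj : j ≠ 0) : ¬ HasSlotZeroWeight 𝒰 x 0 :=
  fun h0 => hj (h.unique h0)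

end SlotZero

/-! ## The registered stub `stub_slotZeroDiamondWeight` (signature inlined verbatim) and its
conditional refutation -/

section Refutation

variable {F : Type} [Field F] [NumberField F] {p : ℕ} [Fact p.Prime]

/-- **What the stub says, in terms of weights**: `hstub` is the registered signature of
`stub_slotZeroDiamondWeight` (skeleton rev 2, sha 540463fb…), byte-for-byte; under its hypotheses, slot `0`
of `x` has weight `0`. [folklore] -/
theorem hasSlotZeroWeight_zero_of_stub
    (hstub : ∀ (F : Type) [Field F] [NumberField F], NumberField.IsTotallyComplex F → Module.finrank ℚ F = 2 → ∀ (p : ℕ) [Fact p.Prime], p ≠ 2 → ∀ (ρ : Literature.NumberTheory.GaloisRepresentations.FramedGaloisRep F (PadicAlgCl p) 2) (𝒰 : Literature.NumberTheory.Automorphic.BigHeckeGLn.TameLevel 2 F p) (x : Literature.NumberTheory.Automorphic.OrdinaryHeckeAlgebraGLn 𝒰 →+* PadicAlgCl p) (k m : ℕ), ρ.toGaloisRep.IsIrreducible → 𝒰.IsMaximalAbove → Continuous x → 𝒰.IsOrdAssociated x ρ → 2 ≤ k → 0 < m → (∀ v : IsDedekindDomain.HeightOneSpectrum (NumberField.RingOfIntegers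 F), (p : NumberField.RingOfIntegers F) ∈ v.asIdeal → ρ.IsOrdinaryOfWeightAt p v k m) → ∃ N : ℕ, 0 < N ∧ ∀ (u : NumberField.RingOfIntegers F) (û : ∀ v : IsDedekindDomain.HeightOneSpectrum (NumberField.RingOfIntegers F), (p : NumberField.RingOfIntegers F) ∈ v.asIdeal → (v.adicCompletionIntegers F)ˣ), (∀ (v : IsDedekindDomain.HeightOneSpectrum (NumberField.RingOfIntegers F)) (hv : (p : NumberField.RingOfIntegers F) ∈ v.asIdeal), ((û v hv : v.adicCompletionIntegers F) : v.adicCompletion F) = algebraMap F (v.adicCompletion F) (u : F)) → (∏ᶠ v : {v : IsDedekindDomain.HeightOneSpectrum (NumberField.RingOfIntegers F) // (p : NumberField.RingOfIntegers F) ∈ v.asIdeal}, x (𝒰.ordDiamond v.2 (Pi.mulSingle (0 : Fin 2) (û v.1 v.2)))) ^ N = 1)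
    (hF : IsTotallyComplex F) (hdeg : Module.finrank ℚ F = 2) (hp : p ≠ 2)
    (ρ : FramedGaloisRep F (PadicAlgCl p) 2) (𝒰 : TameLevel 2 F p)
    (x : OrdinaryHeckeAlgebraGLn 𝒰 →+* PadicAlgCl p) (k m : ℕ)
    (hirr : ρ.toGaloisRep.IsIrreducible) (hmax : 𝒰.IsMaximalAbove) (hx : Continuous x)
    (hass : 𝒰.IsOrdAssociated x ρ) (hk : 2 ≤ k) (hm : 0 < m)
    (hord : ∀ v : HeightOneSpectrum (𝓞 F), (p : 𝓞 F) ∈ v.asIdeal → ρ.IsOrdinaryOfWeightAt p v k m) :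
    HasSlotZeroWeight 𝒰 x 0 :=
  (hasSlotZeroWeight_zero_iff 𝒰 x).2 (hstub F hF hdeg p hp ρ 𝒰 x k m hirr hmax hx hass hk hm hord)

/-- **Conditional refutation of `stub_slotZeroDiamondWeight`.** ONE continuous point `x` of
`𝕋^{S,ord}(𝒰)` meeting the stub's hypotheses (ord-associated with an irreducible `ρ` that is
Galois-ordinary of parallel weight `k ≥ 2`, exponent `m > 0`, at every `v ∣ p`; `𝒰` maximal above
`p`; `F` imaginary quadratic, `p` odd) whose slot-`0` weight is some `j ≠ 0` refutes the stub (the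
conclusion is `¬` the registered signature, verbatim). The companion (anti-dominant) ordinary refinement
of any split-at-`p` classical point is such an `x` (`j = ±(k-1)`); see the module docstring. [folklore] -/
theorem stubSlotZeroDiamondWeight_false_of_hasSlotZeroWeight
    (hF : IsTotallyComplex F) (hdeg : Module.finrank ℚ F = 2) (hp : p ≠ 2)
    (ρ : FramedGaloisRep F (PadicAlgCl p) 2) (𝒰 : TameLevel 2 F p)
    (x : OrdinaryHeckeAlgebraGLn 𝒰 →+* PadicAlgCl p) (k m : ℕ)
    (hirr : ρ.toGaloisRep.IsIrreducible) (hmax : 𝒰.IsMaximalAbove) (hx : Continuous x)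
    (hass : 𝒰.IsOrdAssociated x ρ) (hk : 2 ≤ k) (hm : 0 < m)
    (hord : ∀ v : HeightOneSpectrum (𝓞 F), (p : 𝓞 F) ∈ v.asIdeal → ρ.IsOrdinaryOfWeightAt p v k m)
    {j : ℤ} (hj : j ≠ 0) (hH : HasSlotZeroWeight 𝒰 x j) :
    ¬ (∀ (F : Type) [Field F] [NumberField F], NumberField.IsTotallyComplex F → Module.finrank ℚ F = 2 → ∀ (p : ℕ) [Fact p.Prime], p ≠ 2 → ∀ (ρ : Literature.NumberTheory.GaloisRepresentations.FramedGaloisRep F (PadicAlgCl p) 2) (𝒰 : Literature.NumberTheory.Automorphic.BigHeckeGLn.TameLevel 2 F p) (x : Literature.NumberTheory.Automorphic.OrdinaryHeckeAlgebraGLn 𝒰 →+* PadicAlgCl p) (k m : ℕ), ρ.toGaloisRep.IsIrreducible → 𝒰.IsMaximalAbove → Continuous x → 𝒰.IsOrdAssociated x ρ → 2 ≤ k → 0 < m → (∀ v : IsDedekindDomain.HeightOneSpectrum (NumberField.RingOfIntegers F), (p : NumberField.RingOfIntegers F) ∈ v.asIdeal → ρ.IsOrdinaryOfWeightAt p v k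 m) → ∃ N : ℕ, 0 < N ∧ ∀ (u : NumberField.RingOfIntegers F) (û : ∀ v : IsDedekindDomain.HeightOneSpectrum (NumberField.RingOfIntegers F), (p : NumberField.RingOfIntegers F) ∈ v.asIdeal → (v.adicCompletionIntegers F)ˣ), (∀ (v : IsDedekindDomain.HeightOneSpectrum (NumberField.RingOfIntegers F)) (hv : (p : NumberField.RingOfIntegers F) ∈ v.asIdeal), ((û v hv : v.adicCompletionIntegers F) : v.adicCompletion F) = algebraMap F (v.adicCompletion F) (u : F)) → (∏ᶠ v : {v : IsDedekindDomain.HeightOneSpectrum (NumberField.RingOfIntegers F) // (p : NumberField.RingOfIntegers F) ∈ v.asIdeal}, x (𝒰.ordDiamond v.2 (Pi.mulSingle (0 : Fin 2) (û v.1 v.2)))) ^ N = 1) := fun hstub =>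
  hH.not_weight_zero hj
    (hasSlotZeroWeight_zero_of_stub hstub hF hdeg hp ρ 𝒰 x k m hirr hmax hx hass hk hm hord)

end Refutation

end Summit.Langlands.Langlands.Theorems.ProModularOrdinaryClassical.Negative
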